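import Summits.HodgeConjecture.HodgeConjecture.Theorems.VHCAbelianSchemesRoadSecantQuotientAnchorTransport
import Summits.HodgeConjecture.HodgeConjecture.Theorems.VHCAbelianSchemesRoadSecantAnchorInhabited
import Literature.AlgebraicGeometry.HodgeTheory.SecantQuotientJacobianTwistedCarrier
import HarnessLib

/-!
# Road b02 (`VHCAbelianSchemesRoad`, D-0059) — THE GEOMETRIC SECANT–QUOTIENT ANCHORS ARE INHABITED AND SERVED, modulo the IDENTIFIED
# preprint claim (plate P1 of skeleton v3 of crux `SemiregularSheafRepresentativesTwAtDiag`, item stmt-HodgeConjecture-19787)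

research route conditional on HC_CM; not a corollary; Q11.4-sentence-2 already refuted in dim ≥ 3.

THEOREMS ONLY (no definition, no new hypothesis kind, `HC_CM` nowhere, no statement of any item touched). Skeleton v3 PROPER of the crux
(ring2 LEAD gen 152, `Cruxes/SemiregularSheafRepresentativesTwAtDiag/Lines/birth.lean` dcfb71156c3b06fb) cuts the `(6, 3)` rung along the
GEOMETRIC anchor data `(secantQuotientAnchors, secantQuotientServedClasses)` of `…SecantQuotientAnchorDefs` (p506550): stub (2a′)
`SecantQuotientAnchorCarrier63 C` (a pinned twisted datum at every polarised secant quotient `(J × Ĵ)/Ḡ` in every rational off-ray Weil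
direction) and stub (2b′) `SecantQuotientResidual63 C` (the rung on the pencils with NO served secant-quotient fibre). The first prover
target P1 of the line card v3 (c992eab5f80d) asks for the C2-currency statement: a pencil of the cell's shape, in regime 2, that HAS a served
secant-quotient fibre — so that (2b′) genuinely EXCLUDES a pencil and (2a′) genuinely asserts a datum. This file delivers it, and the
variety-level statements around it, from TWO displayed inputs and nothing else:

* `hM : Literature.AlgebraicGeometry.HodgeTheory.Markman2025_secantQuotient_twistedCarrier_onJacobian C AdmTw` — the IDENTIFIED object-level
  form of Markman's preprint (arXiv:2502.03415, UNREFEREED; `HodgeTheory/SecantQuotientJacobianTwistedCarrier.lean`, p507959, seat b02 gen 88): for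
  every even `d ≥ 4` THERE ARE data `(C, 𝒥, Θ, G₁, G₂)` — exactly the fields of `SecantQuotientDatum` — and classes `(θ, γ)` on
  `Y = Markman2025.secantQuotient …` satisfying VERBATIM the clauses of `IsSecantQuotientWeilClassAt` at the identity chart, with a pinned
  `AdmTw`-datum serving `(e^*θ, e^*γ)` on every copy `e : X' ≅ Y`. RENDERING SENTENCE (finding F7, LEAD ruling L152.4b): the carrier's operator
  `Markman2025.weilOperator` `φ_d` is the CONJUGATE `σ ∘ η(√-d) ∘ σ⁻¹` of print's operator by the involution `σ(x, y) = (φ_Θ⁻¹ y, φ_Θ x)` of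
  `J × Ĵ`, which preserves `Ḡ` and descends to `σ̄ ∈ Aut(Y_d)`; every statement here that is pinned to `weilOperator` is print's statement
  TRANSPORTED ALONG `σ̄` (the claim's witness is `(σ̄^*h, σ̄^*γ₀, σ̄^*𝓔̄)`).
* `hsup : SecantAnchorWeilPencilSupply` — the ONE displayed family-supply hypothesis of the cell (ring2-b03 g76, `…SecantAnchorInhabitedDefs`,
  p498645; `Ring2.Hypotheses` kind, NOT a fact): a split-Weil sixfold with the listed Weil data and a rational off-ray Weil class `γ` lies on a
  CELL-SHAPED pencil through it continuing `γ` by a somewhere-exceptional class (`exceptionalPencilClassesThrough 6 3`). Needed ONLY for the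
  regime-2 statements (§3): at the anchor itself the served class is algebraic-LEFSCHETZ for generic `C` (finding F2), so the constant pencil
  (§2) satisfies every binder EXCEPT regime 2.

CONTENTS. §1 (variety level, modulo `hM` alone): `exists_secantQuotientDatum_of_onJacobian` (for every even `d ≥ 4` a `SecantQuotientDatum D`
with `D.d = d` and `(θ, γ)` with `IsSecantQuotientWeilClassAt D.Y.X θ γ` plus the every-copy datum); the anchor locus is non-empty; (2a′) IS MET
AT PRINT'S ANCHOR IN PRINT'S DIRECTION (`exists_anchoredDatum_secantQuotient_of_onJacobian`: an anchor, a served rational ALGEBRAIC class `γ` and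
a pinned datum with `κ₃ = 1·γ + c₃θ³` — the citation-expected sub-case of stub (2a′), by inhabitation; (2a′) itself exceeds print by the gaps
(G1)–(G3) of the Defs file and is NOT claimed); and the refinement `secantQuotientAnchor_twistedCarrier_sixfold_of_onJacobian` (the identified
claim implies the existential claim `Markman2025_secantQuotientAnchor_twistedCarrier_sixfold`, p497016). §2 (pencil level, modulo `hM` alone):
the constant pencil `D.Y × 𝔸¹` satisfies EVERY binder of the cell `(6, 3)` and HAS A SERVED FIBRE for the geometric data (chart = the slice
isomorphism, `hasServedFibre_secantQuotient_of_chart_Y` of P2); the `¬ ∀` forms. §3 (pencil level, regime 2, modulo `hM` and `hsup`): P1 =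
`exists_hasServedFibre_63_secantQuotient_of_onJacobian_of_supply` — a pencil satisfying every binder of `LefAtExceptionalRegimeAt _ 6 3`, with
`W` fibrewise rational `(3,3)`, algebraic at the anchor fibre and NOT algebraic-Lefschetz everywhere, that HAS a served secant-quotient fibre —
and its `¬ ∀` forms (the hypothesis of `under_not_iff_of_forall_not` FAILS; the residual (2b′) excludes a pencil of the rung's shape).

Nothing here says (2a′), (2b′), the rung, the crux, any cell, K-SR♭∃, VHC, `HC_AV`, `HC_CM` or HC holds. References:
[cite: Markman2025SecantWeil, §1.5, Thm. 1.4.1, Lemma 3.1.3, Remark 9.3.7 and Lemma 9.3.11] [cite: Bloch1972Semiregularity, Remark (7.5)]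
[cite: vanGeemen1994HodgeAV, Thm. 4.11 and 5.3–5.5] [cite: Hartshorne1977, II.3 (p. 89) and II Ex. 4.9] [cite: Fulton1998, Prop. 19.1.2].
-/

noncomputable section

open CategoryTheory CategoryTheory.Limits AlgebraicGeometry Topology MonoidalCategory CartesianMonoidalCategory

-- the cell's namespace repeats the summit name (`Summit.HodgeConjecture.HodgeConjecture…`), as in every `Ring2*` file
set_option linter.dupNamespace false

namespace Summit.HodgeConjecture.HodgeConjecture.Ring2.SemiregularRepresentatives

open Literature.AlgebraicGeometry Literature.AlgebraicGeometry.Motives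
open Literature.AlgebraicGeometry.HodgeTheory Literature.AlgebraicGeometry.Markman2025
open Literature.AlgebraicTopology.SingularHomology
open Literature.Barriers.HodgeConjecture (divisorClassesSpan)
open Summit.Ventures.HSemireg (ObjClass)

/-! ## §1 Variety level: the identified claim produces a secant–quotient datum with its anchor classes and the every-copy datum -/

section VarietyLevel

variable {C : ChernCharacterBetti} {Adm : PerfectAdmissibility}

/-- **FROM THE IDENTIFIED CLAIM TO THE ROAD'S ANCHOR DATA, raw form** (any admissibility notion `Adm`). For every even `d ≥ 4` the
identified claim gives a `SecantQuotientDatum D` with `D.d = d` — its fields ARE the claim's existential data — and classes `(θ, γ)` on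
`D.Y.X` satisfying the clauses of `IsSecantQuotientWeilClassAt` READ ON `D` ITSELF (`D.P`, `D.ψ`, `D.Y`, `D.q` unfold to the carrier
file's terms in one step): `θ` a polarisation class on an ample line of `D.Y`, `(D.P, D.ψ)` hyperbolic for `D.q^*θ`, `γ` rational off
`ℂ·θ³` with `D.q^*γ` a Weil class, and the pinned `Adm`-datum serving `(e^*θ, e^*γ)` on every copy `e : X' ≅ D.Y.X`.
[cite: Markman2025SecantWeil, §1.5 (p. 7), Thm. 1.4.1 and Lemma 3.1.3] -/
theorem exists_secantQuotientDatum_clauses_of_onJacobian (hM : Markman2025_secantQuotient_twistedCarrier_onJacobian C Adm)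
    {d : ℕ} (hd : Even d) (h4 : 4 ≤ d) :
    ∃ (D : SecantQuotientDatum) (θ : complexBetti D.Y.X 2) (γ : complexBetti D.Y.X (2 * 3)),
      D.d = d ∧ IsPolarizationClass 6 D.Y.X θ ∧
      (∃ H : CartierDivisor D.Y.X.left, H.IsAmple ∧ D.Y.IsPolarizationClassOf H θ) ∧
      IsHyperbolicWeilType D.P D.ψ 3 (complexBetti.map D.q.hom.hom.hom 2 θ) ∧
      IsRationalClass γ ∧ γ ∉ (ℂ ∙ cupPowTwo θ 3) ∧
      complexBetti.map D.q.hom.hom.hom (2 * 3) γ ∈ weilClassesOf D.P D.ψ 3 D.d ∧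
      ∀ (X' : SchemeOver ℂ) (e : X' ≅ D.Y.X),
        ∃ (I : Finset ℕ) (κ : (k : ℕ) → complexBetti X' (2 * k)) (c : ℕ → ℂ),
          3 ∈ I ∧ twistedReflexiveClass C Adm 6 X' I κ ∧
          κ 3 = complexBetti.map e.hom (2 * 3) γ + c 3 • cupPowTwo (complexBetti.map e.hom 2 θ) 3 ∧
          ∀ k ∈ I, k ≠ 3 → κ k = c k • cupPowTwo (complexBetti.map e.hom 2 θ) k := by
  obtain ⟨Cᵥ, hC, 𝒥, hdimJ, Θ, hR, hP, G₁, G₂, h₁, h₂, hc₁, hn₁, hc₂, hn₂, hdisj, hgp, h𝒯⟩ := hM d hd h4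
  -- Markman's INPUT data as the road's `SecantQuotientDatum`
  let D : SecantQuotientDatum :=
    { d := d, C := Cᵥ, smooth := hC, 𝒥 := 𝒥, dim_J := hdimJ, Θ := Θ, riemann := hR, principal := hP, G₁ := G₁, G₂ := G₂,
      G₁_le := h₁, G₂_le := h₂, even := hd, four_le := h4, cyclic₁ := hc₁, card₁ := hn₁, cyclic₂ := hc₂, card₂ := hn₂,
      disjoint := hdisj, generalPosition := hgp }
  -- re-type the claim's conclusion over `D`'s projections (so that `D.Y`, `D.P`, `D.ψ`, `D.q` unfold to it in one step)
  have hD : HasTwistedCarrierOnSecantQuotient C Adm D.𝒥.J D.isAmple D.KTheta_eq_bot D.G₁ D.G₂ D.succ_ne_zero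
      D.G₁_le D.G₂_le D.d := h𝒯
  obtain ⟨θ, γ, hpol, hamp, hhyp, hγQ, hγray, hγW, hcopy⟩ := hD
  exact ⟨D, θ, γ, rfl, hpol, hamp, hhyp, hγQ, hγray, hγW, hcopy⟩

/-- **FROM THE IDENTIFIED CLAIM TO THE ROAD'S ANCHOR PREDICATE**: for every even `d ≥ 4`, a `SecantQuotientDatum D` with `D.d = d` and
classes `(θ, γ)` with `IsSecantQuotientWeilClassAt D.Y.X θ γ` (chart `Iso.refl`) plus the pinned `Adm`-datum on every copy of `D.Y.X`.
[cite: Markman2025SecantWeil, §1.5 (p. 7), Thm. 1.4.1 and Lemma 3.1.3] -/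
theorem exists_secantQuotientDatum_of_onJacobian (hM : Markman2025_secantQuotient_twistedCarrier_onJacobian C Adm)
    {d : ℕ} (hd : Even d) (h4 : 4 ≤ d) :
    ∃ (D : SecantQuotientDatum) (θ : complexBetti D.Y.X 2) (γ : complexBetti D.Y.X (2 * 3)),
      D.d = d ∧ IsSecantQuotientWeilClassAt D.Y.X θ γ ∧
      ∀ (X' : SchemeOver ℂ) (e : X' ≅ D.Y.X),
        ∃ (I : Finset ℕ) (κ : (k : ℕ) → complexBetti X' (2 * k)) (c : ℕ → ℂ),
          3 ∈ I ∧ twistedReflexiveClass C Adm 6 X' I κ ∧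
          κ 3 = complexBetti.map e.hom (2 * 3) γ + c 3 • cupPowTwo (complexBetti.map e.hom 2 θ) 3 ∧
          ∀ k ∈ I, k ≠ 3 → κ k = c k • cupPowTwo (complexBetti.map e.hom 2 θ) k := by
  obtain ⟨D, θ, γ, hDd, hpol, hamp, hhyp, hγQ, hγray, hγW, hcopy⟩ := exists_secantQuotientDatum_clauses_of_onJacobian hM hd h4
  have hid2 : complexBetti.map (Iso.refl D.Y.X).inv 2 θ = θ := by
    rw [Iso.refl_inv, complexBetti.map_id]; rfl
  have hid6 : complexBetti.map (Iso.refl D.Y.X).inv (2 * 3) γ = γ := by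
    rw [Iso.refl_inv, complexBetti.map_id]; rfl
  refine ⟨D, θ, γ, hDd, ⟨D, Iso.refl _, hpol, ?_, ?_, hγQ, hγray, ?_⟩, hcopy⟩
  · rw [hid2]; exact hamp
  · rw [hid2]; exact hhyp
  · rw [hid6]; exact hγW

/-- **THE DATUM ON THE ANCHOR ITSELF, with the served class ALGEBRAIC** (identity copy): `κ₃ = γ + c₃θ³` for an `Adm`-admissible twisted
datum ON `D.Y.X`; `γ = κ₃ - c₃θ³` is algebraic since every class of a twisted-door datum on an abelian variety is (`…SecantAnchorInhabited`
§1) and `θ³` is. [cite: Markman2025SecantWeil, Thm. 1.4.1, Cor. 4.0.4 and §1.5] [cite: Fulton1998, Prop. 19.1.2] -/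
theorem exists_secantQuotientDatum_datum_of_onJacobian (hM : Markman2025_secantQuotient_twistedCarrier_onJacobian C Adm)
    {d : ℕ} (hd : Even d) (h4 : 4 ≤ d) :
    ∃ (D : SecantQuotientDatum) (θ : complexBetti D.Y.X 2) (γ : complexBetti D.Y.X (2 * 3)),
      D.d = d ∧ IsSecantQuotientWeilClassAt D.Y.X θ γ ∧ γ ∈ algebraicClasses D.Y.X 3 ∧
      ∃ (I : Finset ℕ) (κ : (k : ℕ) → complexBetti D.Y.X (2 * k)) (c : ℕ → ℂ),
        3 ∈ I ∧ twistedReflexiveClass C Adm 6 D.Y.X I κ ∧ κ 3 = γ + c 3 • cupPowTwo θ 3 ∧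
        ∀ k ∈ I, k ≠ 3 → κ k = c k • cupPowTwo θ k := by
  obtain ⟨D, θ, γ, hDd, hW, hcopy⟩ := exists_secantQuotientDatum_of_onJacobian hM hd h4
  obtain ⟨I, κ, c, h3, hκ, hκ3, hκk⟩ := hcopy D.Y.X (Iso.refl D.Y.X)
  have hid2 : complexBetti.map (Iso.refl D.Y.X).hom 2 θ = θ := by
    rw [Iso.refl_hom, complexBetti.map_id]; rfl
  have hid6 : complexBetti.map (Iso.refl D.Y.X).hom (2 * 3) γ = γ := by
    rw [Iso.refl_hom, complexBetti.map_id]; rfl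
  rw [hid2, hid6] at hκ3
  simp only [hid2] at hκk
  have hκalg : κ 3 ∈ algebraicClasses D.Y.X 3 := mem_algebraicClasses_of_twistedReflexiveClass D.Y hκ h3
  have hθ3 : cupPowTwo θ 3 ∈ algebraicClasses D.Y.X 3 :=
    cupPowTwo_mem_algebraicClasses_of_mem D.isSmoothProjective_Y hW.isPolarizationClass.mem_algebraicClasses 3
  have hγeq : γ = κ 3 - c 3 • cupPowTwo θ 3 := by rw [hκ3, add_sub_cancel_right]
  refine ⟨D, θ, γ, hDd, hW, ?_, I, κ, c, h3, hκ, hκ3, hκk⟩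
  rw [hγeq]
  exact Submodule.sub_mem _ hκalg (Submodule.smul_mem _ _ hθ3)

/-- **The anchor locus of skeleton v3 is NOT EMPTY, modulo the identified claim**: some polarised variety `(X, θ)` is a secant–quotient
anchor — the hypothesis «no anchors» of `under_not_hasServedFibre_iff_of_forall_not` fails for the geometric data, so (2b′) is not the rung
«by emptiness of the anchor set». [cite: Markman2025SecantWeil, §1.5 (p. 7) and Thm. 1.4.1] -/
theorem not_forall_not_secantQuotientAnchors_of_onJacobian (hM : Markman2025_secantQuotient_twistedCarrier_onJacobian C Adm) :
    ¬ ∀ (X : SchemeOver ℂ) (θ : complexBetti X 2), ¬ secantQuotientAnchors X θ := by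
  intro hnone
  obtain ⟨D, θ, γ, -, hW, -⟩ := exists_secantQuotientDatum_of_onJacobian hM (by decide : Even 4) le_rfl
  exact hnone D.Y.X θ ⟨γ, hW⟩

/-- **STUB (2a′) `SecantQuotientAnchorCarrier63` IS MET AT PRINT'S ANCHOR IN PRINT'S DIRECTION, modulo the identified claim** — the
citation-expected sub-case of the anchored-carrier statement, by INHABITATION: there are a secant–quotient anchor `(X, θ)`, a served class
`γ ∈ secantQuotientServedClasses X θ` (rational, algebraic) and a pinned `Adm`-datum ON `X` with `κ₃ = a·γ + c₃·θ³`, `a ≠ 0` (`a = 1`), sides on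
the ray — exactly the conclusion of `AnchoredCarrierAt (tw C Adm) 6 3 𝔄 𝔖` at THIS `(X, θ, γ)`. (2a′) itself — EVERY anchor of the
envelope, EVERY rational off-ray Weil direction — exceeds print by the gaps (G1)–(G3) of `…SecantQuotientAnchorDefs` and is NOT claimed.
[cite: Markman2025SecantWeil, Thm. 1.4.1, §1.5 and Lemma 9.3.11] [cite: Bloch1972Semiregularity, Remark (7.5)] -/
theorem exists_anchoredDatum_secantQuotient_of_onJacobian (hM : Markman2025_secantQuotient_twistedCarrier_onJacobian C Adm) :
    ∃ (X : SchemeOver ℂ) (θ : complexBetti X 2) (γ : complexBetti X (2 * 3)),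
      secantQuotientAnchors X θ ∧ γ ∈ secantQuotientServedClasses X θ ∧ IsRationalClass γ ∧ γ ∈ algebraicClasses X 3 ∧
      ∃ (I : Finset ℕ) (κ : (k : ℕ) → complexBetti X (2 * k)) (a : ℂ) (c : ℕ → ℂ),
        3 ∈ I ∧ twistedReflexiveClass C Adm 6 X I κ ∧ a ≠ 0 ∧ κ 3 = a • γ + c 3 • cupPowTwo θ 3 ∧
        ∀ k ∈ I, k ≠ 3 → κ k = c k • cupPowTwo θ k := by
  obtain ⟨D, θ, γ, -, hW, hγalg, I, κ, c, h3, hκ, hκ3, hκk⟩ :=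
    exists_secantQuotientDatum_datum_of_onJacobian hM (by decide : Even 4) le_rfl
  exact ⟨D.Y.X, θ, γ, ⟨γ, hW⟩, hW, hW.isRationalClass, hγalg, I, κ, 1, c, h3, hκ, one_ne_zero, by rw [one_smul]; exact hκ3, hκk⟩

/-- **The identified claim-fact REFINES the existential one**: `Markman2025_secantQuotient_twistedCarrier_onJacobian C Adm` implies
`Markman2025_secantQuotientAnchor_twistedCarrier_sixfold C Adm` (p497016) — `P := J × Ĵ`, `Y := (J × Ĵ)/Ḡ`, `ψ₀ := φ_d`, `q :=` the quotient
isogeny; `dim P = dim Y = 6`, `φ_d ≫ φ_d = -d` and the bijectivity of `q^*` are THEOREMS of the carrier files, the rest is read off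
(proved here, road-side, so that the Literature file stays statement-only). [cite: Markman2025SecantWeil, §1.5 (p. 7) and Lemma 3.1.3]
[cite: vanGeemen1994HodgeAV, §3.6 (p. 236)] -/
theorem secantQuotientAnchor_twistedCarrier_sixfold_of_onJacobian (hM : Markman2025_secantQuotient_twistedCarrier_onJacobian C Adm) :
    Markman2025_secantQuotientAnchor_twistedCarrier_sixfold C Adm := by
  intro d hd h4
  obtain ⟨Cᵥ, _, 𝒥, hdimJ, Θ, _, hP, G₁, G₂, h₁, h₂, -, -, -, -, -, -, θ, γ, hpol, -, hhyp, hγQ, hγray, hγW, hcopy⟩ :=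
    hM d hd h4
  have hdimP : (𝒥.J.prod (𝒥.J.dualOf Θ hP.isAmple)).dim = 6 := by
    rw [AbelianVariety.dim_prod, AbelianVariety.dim_dualOf, hdimJ]
  have hdimY : (secantQuotient 𝒥.J hP.isAmple G₁ G₂ (Nat.succ_ne_zero d) h₁ h₂).dim = 6 := by
    rw [dim_secantQuotient 𝒥.J hP.isAmple G₁ G₂ (Nat.succ_ne_zero d) h₁ h₂ (AbelianVariety.dim_prod _ _), hdimJ]
  refine ⟨𝒥.J.prod (𝒥.J.dualOf Θ hP.isAmple), secantQuotient 𝒥.J hP.isAmple G₁ G₂ (Nat.succ_ne_zero d) h₁ h₂,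
    weilOperator hP.isAmple hP.KTheta_eq_bot d, secantQuotientMap 𝒥.J hP.isAmple G₁ G₂ (Nat.succ_ne_zero d) h₁ h₂, θ, γ,
    hdimP, hdimY, ?_, complexBetti_map_secantQuotientMap_bijective 𝒥.J hP.isAmple G₁ G₂ (Nat.succ_ne_zero d) h₁ h₂,
    hpol, hhyp, hγQ, hγray, hγW, hcopy⟩
  rw [weilOperator_comp_self, natCast_zsmul]

end VarietyLevel

/-! ## §2 Pencil level, modulo the identified claim ALONE: the constant pencil through the anchor has a served secant–quotient fibre -/

section ConstantPencil

variable {C : ChernCharacterBetti} {Adm : PerfectAdmissibility}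

/-- **THE GEOMETRIC ANCHOR DATA ARE SERVED ON A PENCIL OF THE CELL'S SHAPE, modulo the identified claim alone.** The constant pencil
`pr₂ : D.Y × 𝔸¹ ⟶ 𝔸¹` through the anchor satisfies EVERY binder of the cell `(6, 3)` of K-SR♭∃ (smooth projective of relative dimension `6`,
quasi-projective total space, smooth irreducible affine base of Krull dimension one, abelian fibres, a section), `W := pr₁^*γ` is fibrewise
rational `(3,3)` and ALGEBRAIC at the origin, AND the pencil HAS A SERVED FIBRE for `(secantQuotientAnchors, secantQuotientServedClasses)`:
the origin, polarised by `Θ := pr₁^*θ`, through the chart `(D.Y × 𝔸¹)_{s₀} ≅ D.Y.X` (slice isomorphism; P2's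
`hasServedFibre_secantQuotient_of_chart_Y`). The regime-2 clause is NOT asserted: at the printed anchor every Hodge class is Lefschetz
(finding F2), so `W` may be algebraic-Lefschetz on every fibre. [cite: Hartshorne1977, II.3 (p. 89) and II Ex. 4.9]
[cite: Markman2025SecantWeil, Thm. 1.4.1 and §1.5] [cite: VoisinHodgeI2002, §7.1.2] -/
theorem exists_servedConstantPencil_63_secantQuotient_of_onJacobian (hM : Markman2025_secantQuotient_twistedCarrier_onJacobian C Adm) :
    ∃ (𝒳 S : SchemeOver ℂ) (f : 𝒳 ⟶ S) (W : complexBetti 𝒳 (2 * 3)) (s₀ : ComplexPoints S),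
      IsSmoothProjectiveFamily f 6 ∧ IsQuasiProjectiveOver 𝒳 ∧ IrreducibleSpace S.left ∧ IsAffine S.left ∧
      AlgebraicGeometry.Smooth S.hom ∧ topologicalKrullDim S.left = 1 ∧
      (∀ s : ComplexPoints S, ∃ A' : AbelianVariety ℂ, A'.dim = 6 ∧ Nonempty (A'.X ≅ fiberOver f s)) ∧
      (∃ e : S ⟶ 𝒳, e ≫ f = 𝟙 S) ∧
      (∀ s : ComplexPoints S, IsRationalClass (complexBetti.map (fiberι f s) (2 * 3) W) ∧
        IsOfHodgeType 6 (fiberOver f s) (2 * 3) 3 3 (complexBetti.map (fiberι f s) (2 * 3) W)) ∧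
      complexBetti.map (fiberι f s₀) (2 * 3) W ∈ algebraicClasses (fiberOver f s₀) 3 ∧
      HasServedFibre 6 3 (fun X θ ↦ secantQuotientAnchors X θ) (fun X θ ↦ secantQuotientServedClasses X θ) f W := by
  obtain ⟨D, θ, γ, -, hW, hγalg, -⟩ := exists_secantQuotientDatum_datum_of_onJacobian hM (by decide : Even 4) le_rfl
  have hYsp : IsSmoothProjective 6 D.Y.X := D.isSmoothProjective_Y
  have hpol : IsPolarizationClass 6 D.Y.X θ := hW.isPolarizationClass
  have hγQ : IsRationalClass γ := hW.isRationalClass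
  have hγH : IsOfHodgeType 6 D.Y.X (2 * 3) 3 3 γ := isOfHodgeType_of_mem_algebraicClasses_of_isSmoothProjective hYsp 3 hγalg
  have hθQ : IsRationalClass θ := hpol.isRationalClass
  have hθH : IsOfHodgeType 6 D.Y.X 2 1 1 θ := isOfHodgeType_of_mem_algebraicClasses_of_isSmoothProjective hYsp 1 hpol.mem_algebraicClasses
  haveI : IrreducibleSpace (specOver ℂ (MvPolynomial (Fin 1) ℂ)).left := irreducibleSpace_affineLine_left
  haveI : IsAffine (specOver ℂ (MvPolynomial (Fin 1) ℂ)).left := isAffine_affineLine_left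
  obtain ⟨s₀⟩ := nonempty_complexPoints_affineLine
  have hf : IsSmoothProjectiveFamily (snd D.Y.X (specOver ℂ (MvPolynomial (Fin 1) ℂ))) 6 := isSmoothProjectiveFamily_snd hYsp _
  have h𝒳 : IsQuasiProjectiveOver (D.Y.X ⊗ specOver ℂ (MvPolynomial (Fin 1) ℂ)) :=
    isQuasiProjectiveOver_tensor_of_isProjectiveOver hYsp.isProjectiveOver isQuasiProjectiveOver_affineLine
  have habel : ∀ s : ComplexPoints (specOver ℂ (MvPolynomial (Fin 1) ℂ)),
      ∃ A' : AbelianVariety ℂ, A'.dim = 6 ∧ Nonempty (A'.X ≅ fiberOver (snd D.Y.X (specOver ℂ (MvPolynomial (Fin 1) ℂ))) s) :=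
    fun s ↦ ⟨D.Y, D.dim_Y, ⟨sliceFiberIso D.Y.X s⟩⟩
  have hres := fun s : ComplexPoints (specOver ℂ (MvPolynomial (Fin 1) ℂ)) ↦ map_fiberι_map_fst_eq s (2 * 3) γ
  have hresθ := fun s : ComplexPoints (specOver ℂ (MvPolynomial (Fin 1) ℂ)) ↦ map_fiberι_map_fst_eq s 2 θ
  refine ⟨_, _, snd D.Y.X (specOver ℂ (MvPolynomial (Fin 1) ℂ)), complexBetti.map (fst D.Y.X _) (2 * 3) γ, s₀, hf, h𝒳,
    irreducibleSpace_affineLine_left, isAffine_affineLine_left, smooth_affineLine_hom, topologicalKrullDim_affineLine_left, habel,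
    exists_section_snd D.Y (Iso.refl D.Y.X) _, fun s ↦ ?_, ?_, ?_⟩
  · rw [hres s]
    exact ⟨(isRationalClass_map_iff_of_iso (sliceFiberIso D.Y.X s).symm).2 hγQ,
      (isOfHodgeType_map_iff_of_iso (sliceFiberIso D.Y.X s).symm).2 hγH⟩
  · rw [hres s₀]
    exact (mem_algebraicClasses_map_iff_of_iso (sliceFiberIso D.Y.X s₀).symm).2 hγalg
  · refine hasServedFibre_secantQuotient_of_chart_Y (complexBetti.map (fst D.Y.X _) 2 θ) (fun s ↦ ?_) (fun s ↦ ?_) s₀ D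
      (sliceFiberIso D.Y.X s₀).symm hW (hresθ s₀) (hres s₀)
    · rw [hresθ s]
      exact (isRationalClass_map_iff_of_iso (sliceFiberIso D.Y.X s).symm).2 hθQ
    · rw [hresθ s]
      exact (isOfHodgeType_map_iff_of_iso (sliceFiberIso D.Y.X s).symm).2 hθH

/-- **Hence, modulo the identified claim ALONE, the hypothesis of PART AA's `under_not_iff_of_forall_not` FAILS for the geometric data**:
it is NOT the case that no pencil has a served secant–quotient fibre — the residual (2b′) `SecantQuotientResidual63 C` is not the rung «by
emptiness». [cite: Markman2025SecantWeil, Thm. 1.4.1 and §1.5] [cite: Bloch1972Semiregularity, Remark (7.5)] -/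
theorem not_forall_not_hasServedFibre_63_secantQuotient_of_onJacobian (hM : Markman2025_secantQuotient_twistedCarrier_onJacobian C Adm) :
    ¬ ∀ ⦃𝒳 S : SchemeOver ℂ⦄ (f : 𝒳 ⟶ S) (W : complexBetti 𝒳 (2 * 3)),
      ¬ HasServedFibre 6 3 (fun X θ ↦ secantQuotientAnchors X θ) (fun X θ ↦ secantQuotientServedClasses X θ) f W := by
  intro hnone
  obtain ⟨𝒳, S, f, W, -, -, -, -, -, -, -, -, -, -, -, hserved⟩ := exists_servedConstantPencil_63_secantQuotient_of_onJacobian hM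
  exact hnone f W hserved

/-- **The same with every binder of the cell displayed** (everything except the regime-2 clause): modulo the identified claim, some pencil
satisfying every binder of `LefAtExceptionalRegimeAt _ 6 3`, with `W` fibrewise rational `(3,3)` and algebraic at some fibre, HAS a served
secant–quotient fibre. [cite: Markman2025SecantWeil, Thm. 1.4.1 and §1.5] [cite: Hartshorne1977, II.3 (p. 89)] -/
theorem not_forall_cellBinders_not_hasServedFibre_63_secantQuotient_of_onJacobian
    (hM : Markman2025_secantQuotient_twistedCarrier_onJacobian C Adm) :
    ¬ ∀ ⦃𝒳 S : SchemeOver ℂ⦄ (f : 𝒳 ⟶ S), IsSmoothProjectiveFamily f 6 → IsQuasiProjectiveOver 𝒳 →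
      IrreducibleSpace S.left → IsAffine S.left → AlgebraicGeometry.Smooth S.hom → topologicalKrullDim S.left = 1 →
      (∀ s : ComplexPoints S, ∃ A' : AbelianVariety ℂ, A'.dim = 6 ∧ Nonempty (A'.X ≅ fiberOver f s)) →
      (∃ e : S ⟶ 𝒳, e ≫ f = 𝟙 S) →
      ∀ (W : complexBetti 𝒳 (2 * 3)),
        (∀ s : ComplexPoints S, IsRationalClass (complexBetti.map (fiberι f s) (2 * 3) W) ∧
          IsOfHodgeType 6 (fiberOver f s) (2 * 3) 3 3 (complexBetti.map (fiberι f s) (2 * 3) W)) →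
        ∀ s₀ : ComplexPoints S,
          complexBetti.map (fiberι f s₀) (2 * 3) W ∈ algebraicClasses (fiberOver f s₀) 3 →
          ¬ HasServedFibre 6 3 (fun X θ ↦ secantQuotientAnchors X θ) (fun X θ ↦ secantQuotientServedClasses X θ) f W := by
  intro hnone
  obtain ⟨𝒳, S, f, W, s₀, hf, h𝒳, hirr, haff, hsm, hdim, hab, hsec, hW, halg, hserved⟩ :=
    exists_servedConstantPencil_63_secantQuotient_of_onJacobian hM
  exact hnone f hf h𝒳 hirr haff hsm hdim hab hsec W hW s₀ halg hserved

end ConstantPencil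

/-! ## §3 Pencil level, INSIDE REGIME 2, modulo the identified claim and the displayed family supply — plate P1 -/

section RegimeTwo

variable {C : ChernCharacterBetti} {Adm : PerfectAdmissibility}

/-- **P1 — `exists_hasServedFibre_63_secantQuotient_of_onJacobian_of_supply`: INSIDE REGIME 2, modulo the identified claim and
`SecantAnchorWeilPencilSupply`.** The family supply, fed with the Weil data `(D.P, D.Y, D.ψ, D.q)` of the claim's datum `D` (d = 4) and the
anchor classes `(θ, γ)` (the hypotheses of the supply are exactly the clauses of `IsSecantQuotientWeilClassAt` read on `D`, plus `dim = 6`,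
`φ_d ≫ φ_d = -d` and `q^*` bijective — theorems of the carrier files), yields an exceptional cell-shaped pencil through the anchor
(`γ ∈ exceptionalPencilClassesThrough 6 3 D.Y.X θ`); by PART AA-c / ring2-b03's `exists_servedPencil_of_anchor_of_mem_exceptionalPencilClassesThrough`
with P2's transport `secantQuotient_transport`, that pencil satisfies every binder of the cell `(6, 3)`, its class `W` is fibrewise rational
`(3,3)`, ALGEBRAIC at the anchor fibre (`γ` algebraic by the datum, §1) and NOT algebraic-Lefschetz on every fibre — regime 2 —, and the anchor
fibre is SERVED for `(secantQuotientAnchors, secantQuotientServedClasses)`. [cite: vanGeemen1994HodgeAV, Thm. 4.11 and 5.3–5.5]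
[cite: Markman2025SecantWeil, Thm. 1.4.1, Cor. 4.0.4 and §1.5] [cite: Bloch1972Semiregularity, Remark (7.5)] -/
theorem exists_hasServedFibre_63_secantQuotient_of_onJacobian_of_supply
    (hM : Markman2025_secantQuotient_twistedCarrier_onJacobian C Adm) (hsup : SecantAnchorWeilPencilSupply) :
    ∃ (𝒳 S : SchemeOver ℂ) (f : 𝒳 ⟶ S) (W : complexBetti 𝒳 (2 * 3)) (s₀ : ComplexPoints S),
      IsSmoothProjectiveFamily f 6 ∧ IsQuasiProjectiveOver 𝒳 ∧ IrreducibleSpace S.left ∧ IsAffine S.left ∧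
      AlgebraicGeometry.Smooth S.hom ∧ topologicalKrullDim S.left = 1 ∧
      (∀ s : ComplexPoints S, ∃ A' : AbelianVariety ℂ, A'.dim = 6 ∧ Nonempty (A'.X ≅ fiberOver f s)) ∧
      (∃ e : S ⟶ 𝒳, e ≫ f = 𝟙 S) ∧
      (∀ s : ComplexPoints S, IsRationalClass (complexBetti.map (fiberι f s) (2 * 3) W) ∧
        IsOfHodgeType 6 (fiberOver f s) (2 * 3) 3 3 (complexBetti.map (fiberι f s) (2 * 3) W)) ∧
      complexBetti.map (fiberι f s₀) (2 * 3) W ∈ algebraicClasses (fiberOver f s₀) 3 ∧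
      (¬ ∀ s : ComplexPoints S,
        complexBetti.map (fiberι f s) (2 * 3) W ∈ algebraicClasses (fiberOver f s) 3 ∧
        complexBetti.map (fiberι f s) (2 * 3) W ∈ divisorClassesSpan (fiberOver f s) 6 3) ∧
      HasServedFibre 6 3 (fun X θ ↦ secantQuotientAnchors X θ) (fun X θ ↦ secantQuotientServedClasses X θ) f W := by
  -- the claim's datum at `d = 4`, its raw clauses, and the algebraicity of `γ` from the datum on the identity copy
  obtain ⟨D, θ, γ, hD4, hpol, hamp, hhyp, hγQ, hγray, hγW, hcopy⟩ :=
    exists_secantQuotientDatum_clauses_of_onJacobian hM (by decide : Even 4) le_rfl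
  have hid2 : complexBetti.map (Iso.refl D.Y.X).inv 2 θ = θ := by
    rw [Iso.refl_inv, complexBetti.map_id]; rfl
  have hid6 : complexBetti.map (Iso.refl D.Y.X).inv (2 * 3) γ = γ := by
    rw [Iso.refl_inv, complexBetti.map_id]; rfl
  have hW : IsSecantQuotientWeilClassAt D.Y.X θ γ := by
    refine ⟨D, Iso.refl _, hpol, ?_, ?_, hγQ, hγray, ?_⟩
    · rw [hid2]; exact hamp
    · rw [hid2]; exact hhyp
    · rw [hid6]; exact hγW
  have hγalg : γ ∈ algebraicClasses D.Y.X 3 := by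
    obtain ⟨I, κ, c, h3, hκ, hκ3, -⟩ := hcopy D.Y.X (Iso.refl D.Y.X)
    have hid2' : complexBetti.map (Iso.refl D.Y.X).hom 2 θ = θ := by
      rw [Iso.refl_hom, complexBetti.map_id]; rfl
    have hid6' : complexBetti.map (Iso.refl D.Y.X).hom (2 * 3) γ = γ := by
      rw [Iso.refl_hom, complexBetti.map_id]; rfl
    rw [hid2', hid6'] at hκ3
    have hκalg : κ 3 ∈ algebraicClasses D.Y.X 3 := mem_algebraicClasses_of_twistedReflexiveClass D.Y hκ h3
    have hθ3 : cupPowTwo θ 3 ∈ algebraicClasses D.Y.X 3 :=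
      cupPowTwo_mem_algebraicClasses_of_mem D.isSmoothProjective_Y hpol.mem_algebraicClasses 3
    have hγeq : γ = κ 3 - c 3 • cupPowTwo θ 3 := by rw [hκ3, add_sub_cancel_right]
    rw [hγeq]
    exact Submodule.sub_mem _ hκalg (Submodule.smul_mem _ _ hθ3)
  -- the displayed family supply, fed with `D`'s Weil data
  have hψ : D.ψ ≫ D.ψ = -(D.d • 𝟙 D.P) := by rw [D.ψ_comp_ψ, natCast_zsmul]
  have hd0 : 0 < D.d := by rw [hD4]; decide
  have hpen : γ ∈ exceptionalPencilClassesThrough 6 3 D.Y.X θ :=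
    hsup D.d D.P D.Y D.ψ D.q θ γ hd0 D.dim_P D.dim_Y hψ D.complexBetti_map_q_bijective hpol hhyp hγQ hγray hγW
  exact exists_servedPencil_of_anchor_of_mem_exceptionalPencilClassesThrough secantQuotient_transport D.Y.X θ ⟨γ, hW⟩ γ hW hγalg hpen

/-- **THE PENCIL-LEVEL C2 WITNESS OF SKELETON v3** (`¬ ∀`-form): modulo the identified claim and the displayed family supply it is NOT the case
that every smooth projective abelian-sixfold pencil whose class `W` is somewhere exceptional has NO served secant–quotient fibre — the residual
stub (2b′) `SecantQuotientResidual63 C` EXCLUDES a pencil IN the regime, and the anchored-carrier stub (2a′) is what serves it.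
[cite: Markman2025SecantWeil, Thm. 1.4.1 and §1.5] [cite: vanGeemen1994HodgeAV, Thm. 4.11] [cite: Bloch1972Semiregularity, Remark (7.5)] -/
theorem not_forall_not_hasServedFibre_63_secantQuotient_regimeTwo_of_onJacobian_of_supply
    (hM : Markman2025_secantQuotient_twistedCarrier_onJacobian C Adm) (hsup : SecantAnchorWeilPencilSupply) :
    ¬ ∀ ⦃𝒳 S : SchemeOver ℂ⦄ (f : 𝒳 ⟶ S) (W : complexBetti 𝒳 (2 * 3)), IsSmoothProjectiveFamily f 6 →
      (∀ s : ComplexPoints S, ∃ A' : AbelianVariety ℂ, A'.dim = 6 ∧ Nonempty (A'.X ≅ fiberOver f s)) →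
      (¬ ∀ s : ComplexPoints S,
        complexBetti.map (fiberι f s) (2 * 3) W ∈ algebraicClasses (fiberOver f s) 3 ∧
        complexBetti.map (fiberι f s) (2 * 3) W ∈ divisorClassesSpan (fiberOver f s) 6 3) →
      ¬ HasServedFibre 6 3 (fun X θ ↦ secantQuotientAnchors X θ) (fun X θ ↦ secantQuotientServedClasses X θ) f W := by
  intro hnone
  obtain ⟨𝒳, S, f, W, s₀, hf, -, -, -, -, -, hab, -, -, -, hexc, hserved⟩ :=
    exists_hasServedFibre_63_secantQuotient_of_onJacobian_of_supply hM hsup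
  exact hnone f W hf hab hexc hserved

/-- **The same with EVERY binder of `LefAtExceptionalRegimeAt _ 6 3` displayed** (quasi-projective total space, smooth irreducible affine base of
Krull dimension one, abelian fibres, a section; `W` fibrewise rational `(3,3)`, algebraic at `s₀`, not algebraic-Lefschetz everywhere): the
residual (2b′) genuinely excludes a pencil satisfying every hypothesis of the rung in regime 2, and the restriction of the rung to the served
pencils is not vacuous. [cite: Markman2025SecantWeil, Thm. 1.4.1 and §1.5] [cite: vanGeemen1994HodgeAV, Thm. 4.11] [cite: Bloch1972Semiregularity, Remark (7.5)] -/
theorem not_forall_cell_not_hasServedFibre_63_secantQuotient_of_onJacobian_of_supply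
    (hM : Markman2025_secantQuotient_twistedCarrier_onJacobian C Adm) (hsup : SecantAnchorWeilPencilSupply) :
    ¬ ∀ ⦃𝒳 S : SchemeOver ℂ⦄ (f : 𝒳 ⟶ S), IsSmoothProjectiveFamily f 6 → IsQuasiProjectiveOver 𝒳 →
      IrreducibleSpace S.left → IsAffine S.left → AlgebraicGeometry.Smooth S.hom → topologicalKrullDim S.left = 1 →
      (∀ s : ComplexPoints S, ∃ A' : AbelianVariety ℂ, A'.dim = 6 ∧ Nonempty (A'.X ≅ fiberOver f s)) →
      (∃ e : S ⟶ 𝒳, e ≫ f = 𝟙 S) →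
      ∀ (W : complexBetti 𝒳 (2 * 3)),
        (∀ s : ComplexPoints S, IsRationalClass (complexBetti.map (fiberι f s) (2 * 3) W) ∧
          IsOfHodgeType 6 (fiberOver f s) (2 * 3) 3 3 (complexBetti.map (fiberι f s) (2 * 3) W)) →
        ∀ s₀ : ComplexPoints S,
          complexBetti.map (fiberι f s₀) (2 * 3) W ∈ algebraicClasses (fiberOver f s₀) 3 →
          (¬ ∀ s : ComplexPoints S,
            complexBetti.map (fiberι f s) (2 * 3) W ∈ algebraicClasses (fiberOver f s) 3 ∧
            complexBetti.map (fiberι f s) (2 * 3) W ∈ divisorClassesSpan (fiberOver f s) 6 3) →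
          ¬ HasServedFibre 6 3 (fun X θ ↦ secantQuotientAnchors X θ) (fun X θ ↦ secantQuotientServedClasses X θ) f W := by
  intro hnone
  obtain ⟨𝒳, S, f, W, s₀, hf, h𝒳, hirr, haff, hsm, hdim, hab, hsec, hW, halg, hexc, hserved⟩ :=
    exists_hasServedFibre_63_secantQuotient_of_onJacobian_of_supply hM hsup
  exact hnone f hf h𝒳 hirr haff hsm hdim hab hsec W hW s₀ halg hexc hserved

end RegimeTwo


end Summit.HodgeConjecture.HodgeConjecture.Ring2.SemiregularRepresentatives

end
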